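import Mathlib
import HarnessLib
import Literature.Analysis.UnboundedOperators.HeatExtensionHarnack
import Literature.Analysis.PDE.HeatSubsolutionMeanValue
import Summits.NavierStokesRegularity.NavierStokesRegularity.Theorems.AxisTwistDoorAveragedConeLiouvillePositivityBarrier

/-!
# Route `AxisTwistDoor`, crux `AveragedConeLiouville` (stmt-NavierStokesRegularity-26889), line `lrt_shell` —
# discharging `PositivityPropagationFactC` WITHOUT Nazarov–Ural'tseva, brick P2: THE ONE-STEP SPREADING LEMMA

Quantitative input for the caloric barrier of brick P1 (`barrier_comparison`), in `ℝ³`: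

* `heatKernel_lower` — for `h² ≤ σ ≤ 2h²` and `|z| ≤ 3h`, `G_σ(z) ≥ c₁ h⁻³` with the explicit
  `c₁ = (8π)^{−3/2} e^{−9/4}`;
* `heatExtension_lower` — hence `e^{σΔ} g (x) ≥ c₁ h⁻³ ∫ g` on `B̄(x₁, 2h)` for `0 ≤ g` supported in `B̄(x₁, h)`;
* `heatExtension_lateral` — `e^{σΔ} g (x) ≤ C₂ (h/(R−h))³` at distance `R > h` from `x₁` for `0 ≤ g ≤ 1` supported in
  `B̄(x₁, h)`, uniformly in `σ > 0` (tree: `exists_heatKernel_le_of_le_norm`, the off-diagonal bound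
  `G_σ(z) ≤ C/ρ³` for `|z| ≥ ρ/2`);
* `one_step` — **the one-step spreading lemma**: if `V` is a non-negative classical supersolution of
  `∂ₜV − ΔV + ⟪b, ∇V⟫ ≥ 0`, `|b| ≤ Λ`, on `[s, s+τ] × B̄(x₁, R)` with `2h < R`, `h² ≤ τ ≤ 2h²`, and
  `V(s, ·) ≥ μ g` (`0 ≤ g ≤ 1` continuous, supported in `B̄(x₁, h)`, `μ ≥ 0`), then on `B̄(x₁, 2h)`
  `V(s+τ, ·) ≥ μ (c₁ h⁻³ ∫g − C₂ (h/(R−h))³ − 8Λh)`;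
* `spread_step` — the density-one special case with the constants fixed: there are universal `c⋆ ∈ (0,1)` and
  `N⋆ ≥ 3` such that `V(s, ·) ≥ μ` on `B̄(x₁, h)` implies `V(s+τ, ·) ≥ c⋆ μ` on `B̄(x₁, 2h)` whenever the cylinder
  `[s, s+τ] × B̄(x₁, N⋆h)` is in the domain and `8Λh ≤ c⋆`.

Seat ns-atd-p1 (LEAD g2).  WHAT THIS IS NOT: not a statement about Navier–Stokes regularity; linear parabolic
comparison estimates serving a STAGED door route.  Lands `--supports` the crux item as a helper.
-/

noncomputable section

-- the summit and its single sub-problem share the name (CONVENTIONS §1), as in every Theorems file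
set_option linter.dupNamespace false

namespace Summit.NavierStokesRegularity.NavierStokesRegularity.Theorems.AveragedConeLiouville.PositivityStep

open scoped InnerProductSpace ENNReal Laplacian Topology NNReal
open Set Function MeasureTheory Metric Filter Real
open Literature.Analysis.UnboundedOperators
open Summit.NavierStokesRegularity.NavierStokesRegularity.Theorems.AveragedConeLiouville.PositivityBarrier

/-! ### The heat kernel from below near the pole, at the parabolic scale -/

/-- **Lower bound for the heat kernel at the parabolic scale**: for `h² ≤ σ ≤ 2h²` (`h > 0`) and `|z| ≤ 3h`,
`G_σ(z) ≥ (8π)^{−3/2} e^{−9/4} h⁻³`. -/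
theorem heatKernel_lower {h σ : ℝ} (hh : 0 < h) (hσ1 : h ^ 2 ≤ σ) (hσ2 : σ ≤ 2 * h ^ 2)
    {z : EuclideanSpace ℝ (Fin 3)} (hz : ‖z‖ ≤ 3 * h) :
    (Real.sqrt (8 * π))⁻¹ ^ 3 * Real.exp (-(9 / 4)) / h ^ 3 ≤ heatKernel σ z := by
  have hσ : 0 < σ := lt_of_lt_of_le (by positivity) hσ1
  rw [Literature.Analysis.PDE.heatKernel_eq_inv_sqrt_pow hσ z, finrank_euclideanSpace, Fintype.card_fin]
  -- the normalisation: `√(4πσ) ≤ √(8πh²) = h √(8π)`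
  have h8 : 0 < Real.sqrt (8 * π) := Real.sqrt_pos.2 (by positivity)
  have hs1 : Real.sqrt (4 * π * σ) ≤ h * Real.sqrt (8 * π) := by
    rw [show h * Real.sqrt (8 * π) = Real.sqrt (h ^ 2 * (8 * π)) by
      rw [Real.sqrt_mul (sq_nonneg h), Real.sqrt_sq hh.le]]
    exact Real.sqrt_le_sqrt (by nlinarith [Real.pi_pos])
  have hs0 : 0 < Real.sqrt (4 * π * σ) := Real.sqrt_pos.2 (by positivity)
  have hinv : (h * Real.sqrt (8 * π))⁻¹ ≤ (Real.sqrt (4 * π * σ))⁻¹ := by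
    rw [inv_le_inv₀ (by positivity) hs0]; exact hs1
  have hpow : (h * Real.sqrt (8 * π))⁻¹ ^ 3 ≤ (Real.sqrt (4 * π * σ))⁻¹ ^ 3 :=
    pow_le_pow_left₀ (by positivity) hinv 3
  -- the Gaussian: `|z|²/(4σ) ≤ 9h²/(4h²) = 9/4`
  have hexp : Real.exp (-(9 / 4)) ≤ Real.exp (-‖z‖ ^ 2 / (4 * σ)) := by
    rw [Real.exp_le_exp, neg_div, neg_le_neg_iff, div_le_iff₀ (by positivity)]
    have h1 : ‖z‖ ^ 2 ≤ (3 * h) ^ 2 := pow_le_pow_left₀ (norm_nonneg _) hz 2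
    nlinarith
  have heq : (Real.sqrt (8 * π))⁻¹ ^ 3 * Real.exp (-(9 / 4)) / h ^ 3 =
      (h * Real.sqrt (8 * π))⁻¹ ^ 3 * Real.exp (-(9 / 4)) := by
    rw [mul_inv, mul_pow, inv_pow]
    field_simp
  rw [heq]
  exact mul_le_mul hpow hexp (Real.exp_nonneg _) (by positivity)

/-! ### The caloric extension of a datum supported in a small ball -/

/-- **Interior lower bound**: for continuous compactly supported `g ≥ 0` supported in `B̄(x₁, h)`, `h² ≤ σ ≤ 2h²` and
`x ∈ B̄(x₁, 2h)`, `e^{σΔ} g (x) ≥ (8π)^{−3/2} e^{−9/4} h⁻³ ∫ g`. -/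
theorem heatExtension_lower {g : EuclideanSpace ℝ (Fin 3) → ℝ} (hg : Continuous g) (hgc : HasCompactSupport g)
    (hg0 : ∀ z, 0 ≤ g z) {x₁ : EuclideanSpace ℝ (Fin 3)} {h : ℝ} (hh : 0 < h)
    (hsupp : ∀ z, g z ≠ 0 → z ∈ closedBall x₁ h) {σ : ℝ} (hσ1 : h ^ 2 ≤ σ) (hσ2 : σ ≤ 2 * h ^ 2)
    {x : EuclideanSpace ℝ (Fin 3)} (hx : x ∈ closedBall x₁ (2 * h)) :
    (Real.sqrt (8 * π))⁻¹ ^ 3 * Real.exp (-(9 / 4)) / h ^ 3 * ∫ z, g z ≤ heatExtension g σ x := by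
  have hσ : 0 < σ := lt_of_lt_of_le (by positivity) hσ1
  set c : ℝ := (Real.sqrt (8 * π))⁻¹ ^ 3 * Real.exp (-(9 / 4)) / h ^ 3 with hc
  obtain ⟨M, hM⟩ : ∃ M, ∀ z, ‖g z‖ ≤ M := by
    obtain ⟨M, hM⟩ := (hg.norm.bddAbove_range_of_hasCompactSupport hgc.norm)
    exact ⟨M, fun z => hM (mem_range_self z)⟩
  rw [heatExtension_eq_integral_mul, ← integral_const_mul]
  refine integral_mono ((hg.integrable_of_hasCompactSupport hgc).const_mul c)
    (integrable_heatKernel_sub_mul hg hM hσ x) fun z => ?_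
  -- pointwise: off the support both sides vanish; on it the kernel is `≥ c`
  by_cases hz : g z = 0
  · simp [hz]
  · have hzb : z ∈ closedBall x₁ h := hsupp z hz
    have hdist : ‖x - z‖ ≤ 3 * h := by
      rw [← dist_eq_norm]
      calc dist x z ≤ dist x x₁ + dist x₁ z := dist_triangle _ _ _
        _ ≤ 2 * h + h := add_le_add (mem_closedBall.1 hx) (by rw [dist_comm]; exact mem_closedBall.1 hzb)
        _ = 3 * h := by ring
    exact mul_le_mul_of_nonneg_right (heatKernel_lower hh hσ1 hσ2 hdist) (hg0 z)

/-- **Lateral upper bound**: there is a universal `C₂ ≥ 0` such that for continuous `0 ≤ g ≤ 1` supported in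
`B̄(x₁, h)`, `0 < h < R`, every `σ > 0` and every `x` with `dist x x₁ = R`, `e^{σΔ} g (x) ≤ C₂ (h/(R−h))³`
(`G_σ(x − z) ≤ C/(2(R−h))³` on the support, of volume `(4π/3)h³`). -/
theorem heatExtension_lateral : ∃ C₂ : ℝ, 0 ≤ C₂ ∧
    ∀ (g : EuclideanSpace ℝ (Fin 3) → ℝ), Continuous g → (∀ z, 0 ≤ g z) → (∀ z, g z ≤ 1) →
    ∀ (x₁ : EuclideanSpace ℝ (Fin 3)) (h R : ℝ), 0 < h → h < R → (∀ z, g z ≠ 0 → z ∈ closedBall x₁ h) →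
    ∀ (σ : ℝ), 0 < σ → ∀ (x : EuclideanSpace ℝ (Fin 3)), dist x x₁ = R →
      heatExtension g σ x ≤ C₂ * (h / (R - h)) ^ 3 := by
  obtain ⟨C, hC0, hC⟩ := Literature.Analysis.PDE.exists_heatKernel_le_of_le_norm (E := EuclideanSpace ℝ (Fin 3))
  refine ⟨C * (π * 4 / 3) / 8, by positivity, ?_⟩
  intro g hg hg0 hg1 x₁ h R hh hhR hsupp σ hσ x hx
  have hRh : 0 < R - h := by linarith
  have hgC : ∀ z, ‖g z‖ ≤ 1 := fun z => by rw [Real.norm_of_nonneg (hg0 z)]; exact hg1 z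
  -- the comparison integrand: the constant `C/(2(R−h))³` on the ball `B̄(x₁, h)`
  set k : ℝ := C / (2 * (R - h)) ^ 3 with hk
  have hk0 : 0 ≤ k := by positivity
  have hdom : ∀ z, heatKernel σ (x - z) * g z ≤ (closedBall x₁ h).indicator (fun _ => k) z := by
    intro z
    by_cases hz : g z = 0
    · simp only [hz, mul_zero]
      exact Set.indicator_nonneg (fun _ _ => hk0) z
    · have hzb : z ∈ closedBall x₁ h := hsupp z hz
      rw [indicator_of_mem hzb]
      have hfar : 2 * (R - h) / 2 ≤ ‖x - z‖ := by
        rw [← dist_eq_norm]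
        have h1 : dist x x₁ ≤ dist x z + dist z x₁ := dist_triangle _ _ _
        have h2 : dist z x₁ ≤ h := mem_closedBall.1 hzb
        linarith
      have hK : heatKernel σ (x - z) ≤ k := by
        have := hC hσ (by positivity : 0 < 2 * (R - h)) (x - z) hfar
        simpa [finrank_euclideanSpace, hk] using this
      calc heatKernel σ (x - z) * g z ≤ k * 1 :=
            mul_le_mul hK (hg1 z) (hg0 z) hk0
        _ = k := mul_one k
  have hint : Integrable (fun z => (closedBall x₁ h).indicator (fun _ => k) z)
      (volume : Measure (EuclideanSpace ℝ (Fin 3))) := by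
    refine (integrable_indicator_iff measurableSet_closedBall).2 (integrableOn_const ?_)
    rw [EuclideanSpace.volume_closedBall_fin_three]
    exact ENNReal.mul_ne_top (ENNReal.pow_ne_top ENNReal.ofReal_ne_top) ENNReal.ofReal_ne_top
  rw [heatExtension_eq_integral_mul]
  calc ∫ z, heatKernel σ (x - z) * g z ≤ ∫ z, (closedBall x₁ h).indicator (fun _ => k) z :=
        integral_mono (integrable_heatKernel_sub_mul hg hgC hσ x) hint hdom
    _ = (volume (closedBall x₁ h)).toReal * k := by
        rw [integral_indicator measurableSet_closedBall, setIntegral_const, smul_eq_mul, Measure.real]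
    _ = (π * 4 / 3) * h ^ 3 * k := by
        rw [EuclideanSpace.volume_closedBall_fin_three, ENNReal.toReal_mul, ENNReal.toReal_pow,
          ENNReal.toReal_ofReal hh.le, ENNReal.toReal_ofReal (by positivity)]
        ring
    _ = C * (π * 4 / 3) / 8 * (h / (R - h)) ^ 3 := by
        rw [hk]
        field_simp
        ring

/-! ### The one-step spreading lemma -/

/-- `2 · 2^{3/2} · √(2h²) = 8h` for `h ≥ 0` (the cost `A√τ` of the barrier at `τ ≤ 2h²`). -/
theorem two_mul_rpow_mul_sqrt {h : ℝ} (hh : 0 ≤ h) :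
    2 * (2 : ℝ) ^ ((3 : ℝ) / 2) * Real.sqrt (2 * h ^ 2) = 8 * h := by
  have h32 : (2 : ℝ) ^ ((3 : ℝ) / 2) = 2 * Real.sqrt 2 := by
    rw [show ((3 : ℝ) / 2) = 1 + 1 / 2 by norm_num, Real.rpow_add two_pos, Real.rpow_one,
      Real.sqrt_eq_rpow]
  rw [h32, Real.sqrt_mul (by norm_num : (0:ℝ) ≤ 2), Real.sqrt_sq hh]
  have h2 : Real.sqrt 2 * Real.sqrt 2 = 2 := Real.mul_self_sqrt (by norm_num)
  nlinarith [h2]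

/-- **The one-step spreading lemma.**  There are universal constants `c₁ > 0`, `C₂ ≥ 0` such that: if `V` is `C²`
on an open neighbourhood `W` of the cylinder `[s, s+τ] × B̄(x₁, R)`, `V ≥ 0` there, `∂ₜV − ΔV + ⟪b, ∇V⟫ ≥ 0` with
`|b| ≤ Λ` (`Λ ≥ 0`) on `(s, s+τ] × B(x₁, R)`, `2h < R`, `h² ≤ τ ≤ 2h²`, and `V(s, ·) ≥ μ g` on `B̄(x₁, R)` for a
continuous `0 ≤ g ≤ 1` supported in `B̄(x₁, h)` and `μ ≥ 0`, then
`V(s+τ, x) ≥ μ (c₁ h⁻³ ∫g − C₂ (h/(R−h))³ − 8Λh)` for every `x ∈ B̄(x₁, 2h)`. -/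
theorem one_step : ∃ c₁ C₂ : ℝ, 0 < c₁ ∧ 0 ≤ C₂ ∧
    ∀ (V : ℝ → EuclideanSpace ℝ (Fin 3) → ℝ) (b : ℝ → EuclideanSpace ℝ (Fin 3) → EuclideanSpace ℝ (Fin 3))
      (W : Set (ℝ × EuclideanSpace ℝ (Fin 3))) (x₁ : EuclideanSpace ℝ (Fin 3)) (s τ h R Λ μ : ℝ)
      (g : EuclideanSpace ℝ (Fin 3) → ℝ),
      IsOpen W → Icc s (s + τ) ×ˢ closedBall x₁ R ⊆ W → ContDiffOn ℝ 2 (uncurry V) W → 0 ≤ Λ →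
      (∀ t ∈ Ioc s (s + τ), ∀ x ∈ ball x₁ R, ‖b t x‖ ≤ Λ) →
      (∀ t ∈ Icc s (s + τ), ∀ x ∈ closedBall x₁ R, 0 ≤ V t x) →
      (∀ t ∈ Ioc s (s + τ), ∀ x ∈ ball x₁ R,
        0 ≤ deriv (fun σ => V σ x) t - (Δ (V t)) x + ⟪b t x, gradient (V t) x⟫_ℝ) →
      0 < h → 2 * h < R → h ^ 2 ≤ τ → τ ≤ 2 * h ^ 2 →
      Continuous g → HasCompactSupport g → (∀ z, 0 ≤ g z) → (∀ z, g z ≤ 1) →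
      (∀ z, g z ≠ 0 → z ∈ closedBall x₁ h) → 0 ≤ μ → (∀ x ∈ closedBall x₁ R, μ * g x ≤ V s x) →
      ∀ x ∈ closedBall x₁ (2 * h),
        μ * (c₁ / h ^ 3 * (∫ z, g z) - C₂ * (h / (R - h)) ^ 3 - 8 * Λ * h) ≤ V (s + τ) x := by
  obtain ⟨C₂, hC₂, hlat⟩ := heatExtension_lateral
  refine ⟨(Real.sqrt (8 * π))⁻¹ ^ 3 * Real.exp (-(9 / 4)), C₂, by positivity, hC₂, ?_⟩
  intro V b W x₁ s τ h R Λ μ g hW hWsub hV hΛ hb hV0 hsup hh hhR hτ1 hτ2 hg hgc hg0 hg1 hsupp hμ hinit x hx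
  have hτ : 0 < τ := lt_of_lt_of_le (by positivity) hτ1
  have hRh : 0 < R - h := by linarith
  set m : ℝ := C₂ * (h / (R - h)) ^ 3 with hm
  have hm0 : 0 ≤ m := by positivity
  set A : ℝ := 2 * (2 : ℝ) ^ ((3 : ℝ) / 2) * Λ with hA
  -- the datum vanishes on the sphere `dist x x₁ = R`
  have hlat0 : ∀ y, dist y x₁ = R → g y ≤ m := by
    intro y hy
    have : g y = 0 := by
      by_contra hne
      have := mem_closedBall.1 (hsupp y hne)
      linarith
    rw [this]; exact hm0
  have hlat1 : ∀ t ∈ Ioc s (s + τ), ∀ y, dist y x₁ = R → heatExtension g (t - s) y ≤ m :=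
    fun t ht y hy => hlat g hg hg0 hg1 x₁ h R hh (by linarith) hsupp (t - s) (by linarith [ht.1]) y hy
  have hcomp := barrier_comparison hW hWsub hV hΛ hb hV0 hsup hg hg0 hg1 hμ (le_refl A) hinit hm0 hlat0 hlat1
    (s + τ) ⟨by linarith, le_rfl⟩ x (closedBall_subset_closedBall (by linarith) hx)
  rw [add_sub_cancel_left] at hcomp
  -- the interior lower bound and the cost of the barrier
  have hlow := heatExtension_lower hg hgc hg0 hh hsupp hτ1 hτ2 hx
  have hcost : A * Real.sqrt τ ≤ 8 * Λ * h := by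
    have h1 : Real.sqrt τ ≤ Real.sqrt (2 * h ^ 2) := Real.sqrt_le_sqrt hτ2
    have hA0 : 0 ≤ A := by positivity
    calc A * Real.sqrt τ ≤ A * Real.sqrt (2 * h ^ 2) := mul_le_mul_of_nonneg_left h1 hA0
      _ = (2 * (2 : ℝ) ^ ((3 : ℝ) / 2) * Real.sqrt (2 * h ^ 2)) * Λ := by rw [hA]; ring
      _ = 8 * Λ * h := by rw [two_mul_rpow_mul_sqrt hh.le]; ring
  refine le_trans (mul_le_mul_of_nonneg_left ?_ hμ) hcomp
  linarith

/-! ### The density-one step with fixed constants -/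

/-- **Spreading from a ball, one parabolic step.**  There are universal constants `0 < c⋆ < 1` and `N⋆ ≥ 3` such
that: if `V` is `C²` on an open neighbourhood of `[s, s+τ] × B̄(x₁, N⋆h)`, `V ≥ 0` there,
`∂ₜV − ΔV + ⟪b, ∇V⟫ ≥ 0` with `|b| ≤ Λ` (`Λ ≥ 0`, `8Λh ≤ c⋆`) on `(s, s+τ] × B(x₁, N⋆h)`, `h² ≤ τ ≤ 2h²`, and
`V(s, ·) ≥ μ ≥ 0` on `B̄(x₁, h)`, then `V(s+τ, ·) ≥ c⋆ μ` on `B̄(x₁, 2h)`. -/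
theorem spread_step : ∃ cstar Nstar : ℝ, 0 < cstar ∧ cstar < 1 ∧ 3 ≤ Nstar ∧
    ∀ (V : ℝ → EuclideanSpace ℝ (Fin 3) → ℝ) (b : ℝ → EuclideanSpace ℝ (Fin 3) → EuclideanSpace ℝ (Fin 3))
      (W : Set (ℝ × EuclideanSpace ℝ (Fin 3))) (x₁ : EuclideanSpace ℝ (Fin 3)) (s τ h Λ μ : ℝ),
      IsOpen W → Icc s (s + τ) ×ˢ closedBall x₁ (Nstar * h) ⊆ W → ContDiffOn ℝ 2 (uncurry V) W → 0 ≤ Λ →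
      8 * Λ * h ≤ cstar →
      (∀ t ∈ Ioc s (s + τ), ∀ x ∈ ball x₁ (Nstar * h), ‖b t x‖ ≤ Λ) →
      (∀ t ∈ Icc s (s + τ), ∀ x ∈ closedBall x₁ (Nstar * h), 0 ≤ V t x) →
      (∀ t ∈ Ioc s (s + τ), ∀ x ∈ ball x₁ (Nstar * h),
        0 ≤ deriv (fun σ => V σ x) t - (Δ (V t)) x + ⟪b t x, gradient (V t) x⟫_ℝ) →
      0 < h → h ^ 2 ≤ τ → τ ≤ 2 * h ^ 2 → 0 ≤ μ → (∀ x ∈ closedBall x₁ h, μ ≤ V s x) →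
      ∀ x ∈ closedBall x₁ (2 * h), cstar * μ ≤ V (s + τ) x := by
  obtain ⟨c₁, C₂, hc₁, hC₂, hstep⟩ := one_step
  -- `c⋆ = min (1/2) (c₁ π / 24)`: a quarter of the interior gain `c₁ h⁻³ ∫g ≥ c₁ (4π/3)(h/2)³ h⁻³ = c₁ π / 6`
  set cstar : ℝ := min (1 / 2) (c₁ * π / 24) with hcs
  have hcs0 : 0 < cstar := lt_min (by norm_num) (by positivity)
  have hcs1 : cstar < 1 := lt_of_le_of_lt (min_le_left _ _) (by norm_num)
  have hcsle : cstar ≤ c₁ * π / 24 := min_le_right _ _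
  -- `N⋆` with `C₂ / (N⋆ − 1)³ ≤ c⋆`: take `N⋆ = max 3 (1 + C₂ / c⋆)` (then `(N⋆−1)³ ≥ N⋆ − 1 ≥ C₂/c⋆`)
  set Nstar : ℝ := max 3 (1 + C₂ / cstar) with hNs
  have hN3 : 3 ≤ Nstar := le_max_left _ _
  have hNC : C₂ / cstar ≤ Nstar - 1 := by
    have := le_max_right 3 (1 + C₂ / cstar); rw [← hNs] at this; linarith
  refine ⟨cstar, Nstar, hcs0, hcs1, hN3, ?_⟩
  intro V b W x₁ s τ h Λ μ hW hWsub hV hΛ hΛh hb hV0 hsup hh hτ1 hτ2 hμ hinit x hx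
  -- the datum: a smooth bump `= 1` on `B̄(x₁, h/2)`, supported in `B(x₁, h)`
  let χ : ContDiffBump x₁ := ⟨h / 2, h, by positivity, by linarith⟩
  have hχc : Continuous (χ : EuclideanSpace ℝ (Fin 3) → ℝ) := χ.continuous
  have hχcs : HasCompactSupport (χ : EuclideanSpace ℝ (Fin 3) → ℝ) := χ.hasCompactSupport
  have hχ0 : ∀ z, 0 ≤ χ z := fun z => χ.nonneg
  have hχ1 : ∀ z, χ z ≤ 1 := fun z => χ.le_one
  have hχsupp : ∀ z, χ z ≠ 0 → z ∈ closedBall x₁ h := by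
    intro z hz
    have : z ∈ support (χ : EuclideanSpace ℝ (Fin 3) → ℝ) := hz
    rw [χ.support_eq] at this
    exact ball_subset_closedBall this
  -- `V(s) ≥ μ χ` on the big ball: where `χ ≠ 0` we are in `B̄(x₁, h)` and `χ ≤ 1`; elsewhere `V ≥ 0`
  have hR : 2 * h < Nstar * h := by nlinarith
  have hinit' : ∀ y ∈ closedBall x₁ (Nstar * h), μ * χ y ≤ V s y := by
    intro y hy
    by_cases hz : χ y = 0
    · rw [hz, mul_zero]
      exact hV0 s ⟨le_rfl, by linarith [lt_of_lt_of_le (by positivity : (0:ℝ) < h ^ 2) hτ1]⟩ y hy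
    · exact le_trans (mul_le_of_le_one_right hμ (hχ1 y)) (hinit y (hχsupp y hz))
  have hmain := hstep V b W x₁ s τ h (Nstar * h) Λ μ χ hW hWsub hV hΛ hb hV0 hsup hh hR hτ1 hτ2 hχc hχcs hχ0 hχ1
    hχsupp hμ hinit' x hx
  -- the integral of the bump: `∫ χ ≥ vol B̄(x₁, h/2) = (4π/3)(h/2)³`
  have hint : (π * 4 / 3) * (h / 2) ^ 3 ≤ ∫ z, χ z := by
    have h1 : ∫ z in closedBall x₁ (h / 2), (1 : ℝ) ≤ ∫ z in closedBall x₁ (h / 2), χ z := by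
      refine setIntegral_mono_on (integrableOn_const ?_) (χ.integrable.integrableOn) measurableSet_closedBall
        fun z hz => (χ.one_of_mem_closedBall hz).symm.le
      rw [EuclideanSpace.volume_closedBall_fin_three]
      exact ENNReal.mul_ne_top (ENNReal.pow_ne_top ENNReal.ofReal_ne_top) ENNReal.ofReal_ne_top
    have h2 : ∫ z in closedBall x₁ (h / 2), χ z ≤ ∫ z, χ z :=
      setIntegral_le_integral χ.integrable (Eventually.of_forall hχ0)
    have h3 : ∫ z in closedBall x₁ (h / 2), (1 : ℝ) = (π * 4 / 3) * (h / 2) ^ 3 := by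
      rw [setIntegral_const, smul_eq_mul, mul_one, Measure.real, EuclideanSpace.volume_closedBall_fin_three,
        ENNReal.toReal_mul, ENNReal.toReal_pow, ENNReal.toReal_ofReal (by positivity),
        ENNReal.toReal_ofReal (by positivity)]
      ring
    linarith
  -- bookkeeping of the three terms
  have hterm1 : c₁ * π / 6 ≤ c₁ / h ^ 3 * ∫ z, χ z := by
    have h3 : 0 < h ^ 3 := by positivity
    have : c₁ / h ^ 3 * ((π * 4 / 3) * (h / 2) ^ 3) = c₁ * π / 6 := by field_simp; ring
    rw [← this]
    exact mul_le_mul_of_nonneg_left hint (by positivity)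
  have hterm2 : C₂ * (h / (Nstar * h - h)) ^ 3 ≤ cstar := by
    have hN1 : 0 < Nstar - 1 := by linarith
    have hq : h / (Nstar * h - h) = 1 / (Nstar - 1) := by
      rw [show Nstar * h - h = h * (Nstar - 1) by ring]
      field_simp
    rw [hq]
    have hle1 : (1 / (Nstar - 1)) ^ 3 ≤ 1 / (Nstar - 1) := by
      have h01 : 0 ≤ 1 / (Nstar - 1) := by positivity
      have h11 : 1 / (Nstar - 1) ≤ 1 := by rw [div_le_one hN1]; linarith
      calc (1 / (Nstar - 1)) ^ 3 = (1 / (Nstar - 1)) * ((1 / (Nstar - 1)) * (1 / (Nstar - 1))) := by ring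
        _ ≤ (1 / (Nstar - 1)) * (1 * 1) :=
          mul_le_mul_of_nonneg_left (mul_le_mul h11 h11 h01 zero_le_one) h01
        _ = 1 / (Nstar - 1) := by ring
    have hC : C₂ * (1 / (Nstar - 1)) ≤ cstar := by
      rw [mul_one_div, div_le_iff₀ hN1]
      have := (div_le_iff₀ hcs0).1 hNC
      linarith
    exact le_trans (mul_le_mul_of_nonneg_left hle1 hC₂) hC
  have hkey : cstar ≤ c₁ / h ^ 3 * (∫ z, χ z) - C₂ * (h / (Nstar * h - h)) ^ 3 - 8 * Λ * h := by
    have : 4 * cstar ≤ c₁ * π / 6 := by linarith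
    linarith
  exact le_trans (by rw [mul_comm]; exact mul_le_mul_of_nonneg_left hkey hμ) hmain

end Summit.NavierStokesRegularity.NavierStokesRegularity.Theorems.AveragedConeLiouville.PositivityStep

end
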